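import Literature.MathematicalPhysics.QuantumManyBody.PeriodicBoseGasImpurityTranslation
import Literature.MathematicalPhysics.QuantumManyBody.PeriodicBoseGasFracEnergy
import Mathlib.Analysis.Calculus.FDeriv.Measurable
import HarnessLib

/-!
# The periodic `N`-boson form with an abstract weight: `∫ |∇Ψ|² + W|Ψ|²` on the torus cell

Topic `Literature/MathematicalPhysics/QuantumManyBody`, companion of `PeriodicBoseGas.lean` and
`PeriodicBoseGasImpurity.lean` (namespace `Literature.MathematicalPhysics.QuantumManyBody.BoseGas`).
The tree states the spectral data of the periodic `N`-body Hamiltonian VARIATIONALLY over the Bose-symmetric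
periodic `C¹` core `PeriodicTrialState N L`, but only for the PAIR weight
`W = periodicInteraction v L = ∑_{i<j} v^per(xᵢ - xⱼ)` (`periodicEnergy`, `periodicGroundStateEnergy`) and for the
pinned-scatterer weight `∑_{i<j} v^per(xᵢ - xⱼ) + ∑ⱼ v^per(xⱼ - x)` (`impurityPeriodicEnergy`,
`impurityPeriodicGroundStateEnergy`). The Perron–Frobenius / Faris–Simon package of the tree
(`PeriodicFormDomain.lean` … `PeriodicMaxFormSimplicity.lean`: for `W ∈ L¹` of the cell the bosonic ground state
of `-∑ⱼΔⱼ + W` is simple, [ReedSimonIV1978, Thm XIII.48 (a)]) only ever uses two facts about the weight —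
measurability and `∫_{[0,L)^{3N}} W < ∞` — so it is re-run in the sequel files `PeriodicWeighted*.lean` for an
ABSTRACT weight `W : Config N → [0, ∞]`. This file fixes the two variational objects of that generalisation:

* `periodicEnergyW W Ψ = ∫_{[0,L)^{3N}} |∇Ψ|² + W |Ψ|²` — the quadratic form of `-∑ⱼΔⱼ + W` on a periodic trial
  state (so that `periodicEnergy v = periodicEnergyW (periodicInteraction v L)` DEFINITIONALLY,
  `periodicEnergy_eq_periodicEnergyW`);
* `periodicGroundStateEnergyW W L = inf_Ψ periodicEnergyW W Ψ` — the bottom of the Bose spectrum of `-∑ⱼΔⱼ + W`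
  on the torus `(ℝ³/Lℤ³)^N`, as an infimum over the `C¹` core [ReedSimonIV1978, Thm XIII.1–2];

and the dictionary with the pinned scatterer: `impurityPeriodicEnergy v x = periodicEnergyW (W_v + V_x)`,
`W_v = periodicInteraction v L`, `V_x = impurityInteraction v L x` (`impurityPeriodicEnergy_eq_periodicEnergyW`,
`impurityPeriodicGroundStateEnergy_eq_periodicGroundStateEnergyW`), together with the two hypotheses of the
package for this weight: measurability (`measurable_periodicInteraction_add_impurityInteraction`) and
integrability on the cell for an integrable profile (`lintegral_cellN_impurityInteraction_ne_top`:
`∫_{[0,L)^{3N}} ∑ⱼ v^per(xⱼ - x) dX = N L^{3(N-1)} ∫_{ℝ³} v < ∞`, by `lintegral_cellN_succ` and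
`lintegral_cell_periodizedPotential_sub`).

Only the restriction of `W` to the cell `[0,L)^{3N}` enters; no periodicity or permutation symmetry of `W` is
assumed (the Bose symmetry is carried by the states).

## References

* [ReedSimonIV1978] M. Reed, B. Simon, *Methods of Modern Mathematical Physics IV* (1978), Thm XIII.1–2
  (min–max), §XIII.12 Thm XIII.48 (a).
* [GuentherEtAl2021] N.-E. Guenther et al., Phys. Rev. A 103, 013317 (2021), eq. (4) (static impurity).
* [Fournais2020] S. Fournais, arXiv:2011.00309, (1.1)–(1.2) (the periodic `N`-body Hamiltonian).
-/

noncomputable section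

open MeasureTheory
open scoped ENNReal NNReal

namespace Literature.MathematicalPhysics.QuantumManyBody.BoseGas

variable {N : ℕ} {L : ℝ}

/-! ### Definitions -/

/-- The **periodic `N`-boson energy with weight `W`**:
`periodicEnergyW W Ψ = ∫_{[0,L)^{3N}} (|∇Ψ|² + W |Ψ|²) dX`, the quadratic form of `-∑ⱼΔⱼ + W` (units
`ħ = 2m = 1`) on a periodic Bose-symmetric `C¹` trial state, for an arbitrary weight `W : (ℝ³)^N → [0, ∞]`
(`⊤ · 0 = 0`: hard walls force admissible states to vanish). For `W = ∑_{i<j} v^per(xᵢ - xⱼ)` this is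
`periodicEnergy v` (by `rfl`). [cite: ReedSimonIV1978, Thm XIII.1–2 (the form whose min–max levels are taken)] -/
def periodicEnergyW {N : ℕ} {L : ℝ} (W : Config N → ℝ≥0∞) (Ψ : PeriodicTrialState N L) : ℝ≥0∞ :=
  ∫⁻ X in cellN N L, kineticDensity Ψ.ψ X + W X * (‖Ψ.ψ X‖₊ : ℝ≥0∞) ^ 2

/-- The **bosonic ground-state energy of `-∑ⱼΔⱼ + W` on the torus `(ℝ³/Lℤ³)^N`**:
`periodicGroundStateEnergyW W L = inf_Ψ periodicEnergyW W Ψ` over the periodic Bose-symmetric `C¹` trial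
states (a form core; `⊤` if `L ≤ 0 < N`). [cite: ReedSimonIV1978, Thm XIII.1–2] -/
def periodicGroundStateEnergyW {N : ℕ} (W : Config N → ℝ≥0∞) (L : ℝ) : ℝ≥0∞ :=
  ⨅ Ψ : PeriodicTrialState N L, periodicEnergyW W Ψ

/-! ### Unfolding and the variational principle -/

/-- Unfolding `periodicEnergyW`. [folklore] -/
theorem periodicEnergyW_def (W : Config N → ℝ≥0∞) (Ψ : PeriodicTrialState N L) :
    periodicEnergyW W Ψ = ∫⁻ X in cellN N L, kineticDensity Ψ.ψ X + W X * (‖Ψ.ψ X‖₊ : ℝ≥0∞) ^ 2 :=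
  rfl

/-- Unfolding `periodicGroundStateEnergyW`. [folklore] -/
theorem periodicGroundStateEnergyW_def (W : Config N → ℝ≥0∞) (L : ℝ) :
    periodicGroundStateEnergyW W L = ⨅ Ψ : PeriodicTrialState N L, periodicEnergyW W Ψ :=
  rfl

/-- Variational principle: `E₀(W) ≤ periodicEnergyW W Ψ`. [folklore] -/
theorem periodicGroundStateEnergyW_le (W : Config N → ℝ≥0∞) (Ψ : PeriodicTrialState N L) :
    periodicGroundStateEnergyW W L ≤ periodicEnergyW W Ψ :=
  iInf_le _ Ψ

/-- **The pair energy is the weighted energy of the pair weight** (definitionally). [folklore] -/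
theorem periodicEnergy_eq_periodicEnergyW (v : ℝ → ℝ≥0∞) (Ψ : PeriodicTrialState N L) :
    periodicEnergy v Ψ = periodicEnergyW (periodicInteraction v L) Ψ :=
  rfl

/-- `periodicGroundStateEnergy v N L = periodicGroundStateEnergyW (periodicInteraction v L) L` (definitionally).
[folklore] -/
theorem periodicGroundStateEnergy_eq_periodicGroundStateEnergyW (v : ℝ → ℝ≥0∞) (N : ℕ) (L : ℝ) :
    periodicGroundStateEnergy v N L = periodicGroundStateEnergyW (periodicInteraction (N := N) v L) L :=
  rfl

/-! ### Measurability -/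

/-- The kinetic density of any function is measurable (copy of `measurable_kineticDensity_any` of
`BoseGasThermodynamicLimitRuelle.lean`, kept private to avoid that import). [folklore] -/
private theorem measurable_kineticDensity_W (ψ : Config N → ℂ) : Measurable (kineticDensity ψ) := by
  refine Finset.measurable_sum _ fun i _ => Finset.measurable_sum _ fun k _ => ?_
  exact ((measurable_fderiv_apply_const ℝ ψ _).nnnorm.coe_nnreal_ennreal).pow_const 2

/-- `x ↦ v^per(x)` is measurable (copy of `measurable_periodizedPotential` of
`DiluteBoseGasUpperBoundLocalization.lean`, kept private to avoid that import). [folklore] -/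
private theorem measurable_periodizedPotential_W {v : ℝ → ℝ≥0∞} (hv : Measurable v) (L : ℝ) :
    Measurable (periodizedPotential v L) := by
  unfold periodizedPotential
  exact Measurable.tsum fun n => hv.comp (measurable_id.sub_const _).norm

/-- The pair weight of a measurable profile is measurable (copy of `measurable_periodicInteraction` of
`DiluteBoseGasUpperBoundLocalization.lean`, kept private to avoid that import). [folklore] -/
private theorem measurable_periodicInteraction_W {v : ℝ → ℝ≥0∞} (hv : Measurable v) (L : ℝ) :
    Measurable (periodicInteraction (N := N) v L) := by
  unfold periodicInteraction
  refine Finset.measurable_sum _ fun i _ => Finset.measurable_sum _ fun j _ => ?_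
  exact (measurable_periodizedPotential_W hv L).comp ((measurable_pi_apply i).sub (measurable_pi_apply j))

/-- **The pinned-scatterer weight of a measurable profile is measurable.** [folklore] -/
theorem measurable_impurityInteraction {v : ℝ → ℝ≥0∞} (hv : Measurable v) (L : ℝ) (x : Space) :
    Measurable (impurityInteraction (N := N) v L x) := by
  unfold impurityInteraction
  refine Finset.measurable_sum _ fun j _ => ?_
  have hj : Measurable fun Y : Config N => Y j := measurable_pi_apply j
  exact (measurable_periodizedPotential_W hv L).comp (hj.sub_const x)

/-- **The total weight of the pinned-scatterer problem, `∑_{i<j} v^per(xᵢ - xⱼ) + ∑ⱼ v^per(xⱼ - x)`, is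
measurable.** [folklore] -/
theorem measurable_periodicInteraction_add_impurityInteraction {v : ℝ → ℝ≥0∞} (hv : Measurable v) (L : ℝ)
    (x : Space) : Measurable (periodicInteraction (N := N) v L + impurityInteraction v L x) :=
  (measurable_periodicInteraction_W hv L).add (measurable_impurityInteraction hv L x)

/-- The weighted density `X ↦ W X |ψ X|²` of a continuous `ψ` is measurable. [folklore] -/
theorem measurable_weight_mul_sq {W : Config N → ℝ≥0∞} (hW : Measurable W) {ψ : Config N → ℂ}
    (hψ : Continuous ψ) : Measurable fun X => W X * (‖ψ X‖₊ : ℝ≥0∞) ^ 2 :=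
  hW.mul (hψ.measurable.nnnorm.coe_nnreal_ennreal.pow_const 2)

/-! ### Additivity in the weight and the pinned scatterer -/

/-- **Additivity in the weight**: `periodicEnergyW (W₁ + W₂) Ψ = periodicEnergyW W₁ Ψ + ∫ W₂ |Ψ|²`
(measurable `W₁`). [folklore] -/
theorem periodicEnergyW_add {W₁ : Config N → ℝ≥0∞} (hW₁ : Measurable W₁) (W₂ : Config N → ℝ≥0∞)
    (Ψ : PeriodicTrialState N L) :
    periodicEnergyW (W₁ + W₂) Ψ =
      periodicEnergyW W₁ Ψ + ∫⁻ X in cellN N L, W₂ X * (‖Ψ.ψ X‖₊ : ℝ≥0∞) ^ 2 := by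
  unfold periodicEnergyW
  have hm : Measurable fun X => kineticDensity Ψ.ψ X + W₁ X * (‖Ψ.ψ X‖₊ : ℝ≥0∞) ^ 2 :=
    (measurable_kineticDensity_W Ψ.ψ).add (measurable_weight_mul_sq hW₁ Ψ.contDiff.continuous)
  rw [← lintegral_add_left hm]
  refine lintegral_congr fun X => ?_
  rw [Pi.add_apply, add_mul, add_assoc]

/-- **The pinned-scatterer form is the weighted form of the weight `∑_{i<j} v^per(xᵢ - xⱼ) + ∑ⱼ v^per(xⱼ - x)`.**
[cite: GuentherEtAl2021, eq. (4) (m_I = ∞; quadratic form)] -/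
theorem impurityPeriodicEnergy_eq_periodicEnergyW {v : ℝ → ℝ≥0∞} (hv : Measurable v) (x : Space)
    (Φ : PeriodicTrialState N L) :
    impurityPeriodicEnergy v x Φ = periodicEnergyW (periodicInteraction v L + impurityInteraction v L x) Φ := by
  rw [impurityPeriodicEnergy_eq, periodicEnergyW_add (measurable_periodicInteraction_W hv L)]
  rfl

/-- **The pinned-scatterer ground-state energy is the bosonic ground-state energy of the weight
`∑_{i<j} v^per(xᵢ - xⱼ) + ∑ⱼ v^per(xⱼ - x)`.** [cite: GuentherEtAl2021, eq. (4) (m_I = ∞)] -/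
theorem impurityPeriodicGroundStateEnergy_eq_periodicGroundStateEnergyW {v : ℝ → ℝ≥0∞} (hv : Measurable v)
    (N : ℕ) (L : ℝ) (x : Space) :
    impurityPeriodicGroundStateEnergy v N L x =
      periodicGroundStateEnergyW (periodicInteraction (N := N) v L + impurityInteraction v L x) L := by
  unfold impurityPeriodicGroundStateEnergy periodicGroundStateEnergyW
  exact iInf_congr fun Φ => impurityPeriodicEnergy_eq_periodicEnergyW hv x Φ

/-! ### Integrability of the pinned-scatterer weight on the cell -/

/-- Splitting off the first boson: `∑ⱼ v^per((x₀, Y)ⱼ - x) = v^per(x₀ - x) + ∑ⱼ v^per(Yⱼ - x)`. [folklore] -/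
theorem impurityInteraction_vecCons (v : ℝ → ℝ≥0∞) (L : ℝ) (x x₀ : Space) (Y : Config N) :
    impurityInteraction v L x (Matrix.vecCons x₀ Y) =
      periodizedPotential v L (x₀ - x) + impurityInteraction v L x Y := by
  unfold impurityInteraction
  rw [Fin.sum_univ_succ]
  simp only [Matrix.cons_val_zero, Matrix.cons_val_succ]

/-- **The pinned-scatterer weight of an integrable profile is integrable on the cell**:
`∫_{[0,L)^{3N}} ∑ⱼ v^per(xⱼ - x) dX < ∞` whenever `∫_{ℝ³} v(|y|) dy < ∞` (`= N L^{3(N-1)} ∫ v`; induction on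
`N` with `lintegral_cellN_succ` and `∫_{[0,L)³} v^per(y - x) dy = ∫_{ℝ³} v`). [folklore] -/
theorem lintegral_cellN_impurityInteraction_ne_top (hL : 0 < L) {v : ℝ → ℝ≥0∞} (hv : Measurable v)
    (hint : (∫⁻ y : Space, v ‖y‖) ≠ ⊤) (x : Space) (N : ℕ) :
    ∫⁻ X in cellN N L, impurityInteraction v L x X ≠ ⊤ := by
  induction N with
  | zero =>
    have h0 : ∀ X : Config 0, impurityInteraction v L x X = 0 := fun X => by simp [impurityInteraction]
    simp [h0]
  | succ m ih =>
    have hinner : ∀ Y : Config m, ∫⁻ x₀ in cell L, impurityInteraction v L x (Matrix.vecCons x₀ Y) =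
        (∫⁻ z : Space, v ‖z‖) + impurityInteraction v L x Y * ENNReal.ofReal L ^ 3 := by
      intro Y
      simp only [impurityInteraction_vecCons]
      rw [lintegral_add_right _ measurable_const, setLIntegral_const, volume_cell,
        lintegral_cell_periodizedPotential_sub hL hv]
    rw [lintegral_cellN_succ L (measurable_impurityInteraction hv L x)]
    simp only [hinner]
    rw [lintegral_add_left measurable_const, setLIntegral_const, volume_cellN,
      lintegral_mul_const _ (measurable_impurityInteraction hv L x)]
    exact ENNReal.add_ne_top.2 ⟨ENNReal.mul_ne_top hint (ENNReal.pow_ne_top (ENNReal.pow_ne_top ENNReal.ofReal_ne_top)),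
      ENNReal.mul_ne_top ih (ENNReal.pow_ne_top ENNReal.ofReal_ne_top)⟩

end Literature.MathematicalPhysics.QuantumManyBody.BoseGas

end
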